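import Summits.FinalStateConjecture.FinalStateConjecture.Theses.PhotonSphereChannels

/-!
# Sketch — crux idea `shield-split-recollapse` for `PhotonSphereChannels.TameCensorship`
(crux item stmt-FinalStateConjecture-10047; planner-cruxidea …-10047-2-0, round 1)

The SHIELD SPLIT of the tame property `Q` of `TameCensorship`: every clause of `Q` is evaluated
either on objects *in contact with infinity* (ESCAPING: causal-past trace on the data manifold not
precompact / chart images not eventually inside a compact domain of dependence) or on SHIELDED
objects (living in `D⁺(ι K)` for a compact `K ⊆ X`).  The escaping half is exterior-determined and
falls to the burial engine of route `SwallowTheDatum`; the shielded half is exactly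
`CompactDomainsAreMortal` ("eternal vacuum bags do not occur", a closed-universe-recollapse-type
statement).  This file only states the objects and the first checkable lemmas; nothing is proved.
-/

open Literature.Geometry.Lorentzian
open scoped Manifold ContDiff Topology
open Filter Set

noncomputable section

namespace Summit.FinalStateConjecture.FinalStateConjecture.Cruxes.TameCensorship.ShieldSplit

section Defs

variable {X : Type} [TopologicalSpace X] [ChartedSpace E3 X] [IsManifold (𝓡 3) ∞ X]
  [ConnectedSpace X] {D : InitialDataSet (𝓡 3) X}

/-- `S` is SHIELDED in the Cauchy development `𝒟`: it lies in the future Cauchy development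
`D⁺(ι K)` of the image of a compact subset `K` of the data manifold. -/
def IsShielded (𝒟 : CauchyDevelopment D) (S : Set 𝒟.carrier) : Prop :=
  ∃ K : Set X, IsCompact K ∧
    S ⊆ 𝒟.metric.futureCauchyDevelopment 𝒟.timeOrientation (𝒟.embed '' K)

/-- `S` has PRECOMPACT CAUSAL-PAST TRACE on the data: `ι⁻¹(J⁻(S))` lies in a compact set. -/
def HasPrecompactPastTrace (𝒟 : CauchyDevelopment D) (S : Set 𝒟.carrier) : Prop :=
  ∃ K : Set X, IsCompact K ∧ 𝒟.embed ⁻¹' (𝒟.metric.causalPast 𝒟.timeOrientation S) ⊆ K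

/-- Ray selector: the future branch of the ray `γ` (parameters `dom ∩ [0,∞)`) is SHIELDED iff its
causal-past trace on the data is precompact; ESCAPING is the negation. -/
def IsShieldedRay (𝒟 : CauchyDevelopment D) (γ : ℝ → 𝒟.carrier) (dom : Set ℝ) : Prop :=
  HasPrecompactPastTrace 𝒟 (γ '' (dom ∩ Set.Ici 0))

/-- The LATE POLAR NEAR ZONE `{t* > τ₁, r ≤ 3M, |z| ≥ r/2}` of the boosted Kerr background
(Kerr–Schild `z = r cos θ`, so `|cos θ| ≥ 1/2`): it contains the axis worldlines `r = 2M, θ = 0`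
(timelike for extremal Kerr: `g_tt = −(r−M)²/(r²+M²)`), and at its points the complex quadratic
Weyl invariant `48 M²/(r − i a cos θ)⁶` of EXTREMAL Kerr (`a = M`) has argument in `(56°, 270°]`,
bounded away from the positive real axis where Schwarzschild's invariant `48 M²/r⁶` lies. -/
def latePolarNearZone (Λ : lorentzGroup) (c : E4) (M a : ℝ) (τ₁ : ℝ) :
    Set (boostedKerrBackground Λ c M a).domain :=
  {x | x ∈ (boostedKerrBackground Λ c M a).lateRegion τ₁ ∧
    (boostedKerrBackground Λ c M a).radius x.1 ≤ 3 * M ∧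
    (boostedKerrBackground Λ c M a).radius x.1 / 2 ≤ |poincareInv Λ c x.1 3|}

/-- Chart selector: a late chart modelled on boosted Kerr `(Λ, c, M, a)` is POLAR-SHIELDED iff the
image of some late polar near zone is shielded (lies in a compact domain of dependence). -/
def IsPolarShieldedChart (𝒟 : CauchyDevelopment D) (Λ : lorentzGroup) (c : E4) (M a : ℝ)
    (Ψ : (boostedKerrBackground Λ c M a).domain → 𝒟.carrier) : Prop :=
  ∃ τ₁ : ℝ, IsShielded 𝒟 (Ψ '' latePolarNearZone Λ c M a τ₁)

/-- Clause (i) of `TameCensorship` (no late chart converging in `C²` on the near-zone slabs to a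
boosted EXTREMAL Kerr exterior), restricted to charts selected by `sel`. With `sel := fun _ _ ↦ True`
this is verbatim clause (i). -/
def NoExtremalRemnant (𝒟 : VacuumCauchyDevelopment D)
    (sel : ∀ (Λ : lorentzGroup) (c : E4) (M a : ℝ),
      ((boostedKerrBackground Λ c M a).domain → 𝒟.carrier) → Prop) : Prop :=
  ∀ (Λ : lorentzGroup) (c : E4) (M a : ℝ), Kerr.IsExtremal M a →
    ¬ ∃ (τ₀ : ℝ) (Ψ : (boostedKerrBackground Λ c M a).domain → 𝒟.carrier),
      𝒟.toSpacetime.IsLateChart (boostedKerrBackground Λ c M a) Set.univ τ₀ Ψ ∧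
      sel Λ c M a Ψ ∧
      ∀ R : ℝ, Tendsto (fun τ ↦ 𝒟.toSpacetime.truncDeviationCk
        (boostedKerrBackground Λ c M a) Ψ 2 R τ) atTop (𝓝 0)

/-- Clause (ii) of `TameCensorship` (bounded `C³` geometry of the ray-theoretic outer region at a
uniform scale), with the future-complete normalised null rays building `outer` restricted to those
selected by `sel`. With `sel := fun _ _ ↦ True` this is verbatim clause (ii). -/
def TameOuter (𝒟 : VacuumCauchyDevelopment D)
    (sel : (ℝ → 𝒟.carrier) → Set ℝ → Prop) : Prop :=
  ∀ [𝒟.metric.HasLeviCivita],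
    let outer : Set 𝒟.carrier :=
      𝒟.metric.causalFuture 𝒟.timeOrientation (Set.range 𝒟.embed) ∩
        {q | ∃ (p : X) (γ : ℝ → 𝒟.carrier) (dom : Set ℝ),
          𝒟.metric.IsNormalisedNullRayFrom 𝒟.timeOrientation 𝒟.embed 𝒟.normal p γ dom ∧
          ¬ BddAbove dom ∧ sel γ dom ∧
          q ∈ 𝒟.metric.chronologicalPast 𝒟.timeOrientation (γ '' (dom ∩ Set.Ici 0))};
    ∃ r₀ : ℝ, 0 < r₀ ∧ ∃ Λ : NNReal, ∀ q ∈ outer,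
      let U : TopologicalSpace.Opens E4 := ⟨Metric.ball (0 : E4) r₀, Metric.isOpen_ball⟩;
      ∃ Ψ : U → 𝒟.carrier,
        𝒟.toSpacetime.IsLateChart (Minkowski.backgroundOn U) Set.univ (-r₀) Ψ ∧
        (∃ x : U, (x : E4) = 0 ∧ Ψ x = q) ∧
        supCkENorm (U : Set E4) 3 (𝒟.toSpacetime.deviationExtend (Minkowski.backgroundOn U) Ψ)
          ≤ (Λ : ENNReal) ∧
        supCkENorm (U : Set E4) 0 (𝒟.toSpacetime.deviationExtend (Minkowski.backgroundOn U) Ψ)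
          ≤ 1 / 2

/-- ESCAPING half of the tame property: clauses (i), (ii) for charts / rays in contact with infinity. -/
def QEsc (𝒟 : VacuumCauchyDevelopment D) : Prop :=
  NoExtremalRemnant 𝒟 (fun Λ c M a Ψ ↦ ¬ IsPolarShieldedChart 𝒟.toCauchyDevelopment Λ c M a Ψ) ∧
    TameOuter 𝒟 (fun γ dom ↦ ¬ IsShieldedRay 𝒟.toCauchyDevelopment γ dom)

/-- SHIELDED half of the tame property: clauses (i), (ii) for charts / rays inside compact domains
of dependence. -/
def QSh (𝒟 : VacuumCauchyDevelopment D) : Prop :=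
  NoExtremalRemnant 𝒟 (fun Λ c M a Ψ ↦ IsPolarShieldedChart 𝒟.toCauchyDevelopment Λ c M a Ψ) ∧
    TameOuter 𝒟 (fun γ dom ↦ IsShieldedRay 𝒟.toCauchyDevelopment γ dom)

end Defs

/-- SPLIT EQUIVALENCE (support, provable now: case split on the selectors; for (ii) the union of two
outer regions is handled by `min r₀`, `max Λ` and restriction of Minkowski-ball charts to smaller
balls). The typed crux is the curve-genericity of the CONJUNCTION of its escaping and shielded
halves. -/
def SplitEquiv : Prop :=
  Theses.PhotonSphereChannels.TameCensorship ↔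
    ∀ (X : Type) [TopologicalSpace X] [ChartedSpace E3 X] [IsManifold (𝓡 3) ∞ X] [T2Space X]
      [SecondCountableTopology X] [ConnectedSpace X],
      InitialDataSet.IsChristodoulouGeneric (admissibleVacuumData X)
        (fun D ↦ (∃ 𝒟 : VacuumCauchyDevelopment D, 𝒟.IsMaximal) ∧
          ∀ 𝒟 : VacuumCauchyDevelopment D, 𝒟.IsMaximal →
            Summit.FinalStateConjecture.HasCompleteNullInfinity 𝒟.toCauchyDevelopment ∧
              QEsc 𝒟 ∧ QSh 𝒟) 1

/-- FIRST LEMMA (causal core, provable from the Cauchy-hypersurface facts of `Causality.lean`):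
a set in the causal future of the data whose causal past meets the data in a precompact set is
shielded — it lies in `D⁺(ι K)` for a compact `K`. Hence every ETERNAL SHIELDED object of the crux
(future branch of a complete shielded ray; late image of an eventually shielded remnant chart) lives
in a compact domain of dependence, which is determined by the data on `K` alone. -/
def ShieldedOfPrecompactPastTrace : Prop :=
  ∀ (X : Type) [TopologicalSpace X] [ChartedSpace E3 X] [IsManifold (𝓡 3) ∞ X] [T2Space X]
    [SecondCountableTopology X] [ConnectedSpace X] (D : InitialDataSet (𝓡 3) X)
    (𝒟 : CauchyDevelopment D) (S : Set 𝒟.carrier),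
    S ⊆ 𝒟.metric.causalFuture 𝒟.timeOrientation (Set.range 𝒟.embed) →
    HasPrecompactPastTrace 𝒟 S → IsShielded 𝒟 S

/-- C²-RIGIDITY AT POLAR POINTS (stub of `BuriedEscTame`, d-independent, provable by a curvature
computation): a Lorentzian metric `C²`-close on a late polar near-zone point's neighbourhood to
boosted EXTREMAL Kerr cannot be EXACTLY a sub-extremal Kerr–Schild metric there, quantitatively:
there is `ε(M′) > 0` such that no smooth local diffeomorphism pulls `Kerr.bilin M a` (`|a| < M`) back
to within `ε` in `C²` of `Kerr.bilin M′ M′` on a ball around a point with `r′ ≤ 3M′`, `|z′| ≥ r′/2`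
(the complex quadratic Weyl invariant is real positive for... — stated here only in the polar
ARGUMENT form for Schwarzschild targets, the case the sealed `a = 0` burial needs). -/
def PolarRigiditySchwarzschild : Prop :=
  ∀ (Me : ℝ), 0 < Me → ∃ ε : ℝ, 0 < ε ∧ ∀ (M : ℝ) (r₀ : ℝ), 0 < M → 0 < r₀ →
    ∀ (x : E4), x ∈ (Kerr.exterior Me Me : Set E4) → Kerr.radius Me x ≤ 3 * Me →
      Kerr.radius Me x / 2 ≤ |x 3| →
    ∀ (ρ : ℝ), 0 < ρ → ∀ (φ : E4 → E4), ContDiffOn ℝ 3 φ (Metric.ball x ρ) →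
      (∀ y ∈ Metric.ball x ρ, φ y ∈ (Kerr.region 0 r₀ : Set E4)) →
      ¬ (∀ y ∈ Metric.ball x ρ, ∀ n ≤ 2,
          ‖iteratedFDeriv ℝ n (fun z ↦ (Kerr.bilin M 0 (φ z)).bilinearComp
              (fderiv ℝ φ z) (fderiv ℝ φ z) - Kerr.bilin Me Me z) y‖ ≤ ε)

/-- COMPACT DOMAINS OF DEPENDENCE ARE MORTAL (CDM — the residue of the crux after the genericity
escape; "Λ = 0 vacuum cannot sustain an eternal enclosed cosmos"): in every MGHD of an admissible
vacuum datum and for every compact `K ⊆ X`, (a) no future-complete normalised null ray from the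
data has its future branch inside `D⁺(ι K)`, and (b) no future-directed timelike curve on `[0,∞)`
inside `D⁺(ι K)` has infinite proper time. Expected TRUE when the one-point compactification of `X`
is a connected sum of spherical space forms and `S² × S¹`'s (closed-universe recollapse:
Barrow–Galloway–Tipler; Lin–Wald for Bianchi IX), expected FALSE on `X = T³ # ℝ³`, `(H³/Γ) # ℝ³`
(expanding Kasner / Milne fillings, Andersson–Moncrief) — there the shielded half of the crux is an
honest interior third-law statement. -/
def CompactDomainsAreMortal : Prop :=
  ∀ (X : Type) [TopologicalSpace X] [ChartedSpace E3 X] [IsManifold (𝓡 3) ∞ X] [T2Space X]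
    [SecondCountableTopology X] [ConnectedSpace X],
    ∀ D ∈ admissibleVacuumData X, ∀ 𝒟 : VacuumCauchyDevelopment D, 𝒟.IsMaximal →
      ∀ [𝒟.metric.HasLeviCivita], ∀ K : Set X, IsCompact K →
        (∀ (p : X) (γ : ℝ → 𝒟.carrier) (dom : Set ℝ),
            𝒟.metric.IsNormalisedNullRayFrom 𝒟.timeOrientation 𝒟.embed 𝒟.normal p γ dom →
            γ '' (dom ∩ Set.Ici 0) ⊆
              𝒟.metric.futureCauchyDevelopment 𝒟.timeOrientation (𝒟.embed '' K) →
            BddAbove dom) ∧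
        (∀ γ : ℝ → 𝒟.carrier,
            𝒟.metric.IsFutureTimelikeCurveOn 𝒟.timeOrientation γ (Set.Ici 0) →
            γ '' Set.Ici 0 ⊆ 𝒟.metric.futureCauchyDevelopment 𝒟.timeOrientation (𝒟.embed '' K) →
            BddAbove (Set.range fun T : ℝ ↦ ∫ t in (0 : ℝ)..T,
              Real.sqrt (-(𝒟.metric.val (γ t) (velocity (𝓡 4) γ t) (velocity (𝓡 4) γ t)))))

/-- CDM kills the shielded half (support, provable modulo `ShieldedOfPrecompactPastTrace` and the
Kerr near-zone fact that an extremal-remnant chart's late image contains a timelike curve of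
infinite proper time): under CDM, `QSh` holds in every MGHD of every admissible datum. -/
def QSh_of_CDM : Prop :=
  CompactDomainsAreMortal →
    ∀ (X : Type) [TopologicalSpace X] [ChartedSpace E3 X] [IsManifold (𝓡 3) ∞ X] [T2Space X]
      [SecondCountableTopology X] [ConnectedSpace X],
      ∀ D ∈ admissibleVacuumData X, ∀ 𝒟 : VacuumCauchyDevelopment D, 𝒟.IsMaximal → QSh 𝒟

end Summit.FinalStateConjecture.FinalStateConjecture.Cruxes.TameCensorship.ShieldSplit

end
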